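import Mathlib
import Summits.KontsevichZagierPeriods.Zeta5Search.LaiDecayMax
import Summits.KontsevichZagierPeriods.Zeta5Search.KernelLog
import HarnessLib

/-!
# ζ(5) search — the decay-rate enclosure `α ≥ 38725.5` at the κ₃ ladder point, by one kernel certificate
# (fam-indep, κ₃ ladder, gen 5)

HONEST FRAMING: systematic search; no irrationality claim unless certified. MANUSCRIPT-LEVEL CANDIDATE context
('κ₃ ≤ 73' = `LaiBoxInputs 74 2180 444 δ74 36`); this module certifies ONE real inequality about the cell's own
profile function and makes no statement about ζ(5), a margin, or a dimension.

Cell `pub-zeta5` (summit KontsevichZagierPeriods, topic Zeta5Search), family `indep`. The decay input of the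
κ₃ skeleton is closed in Lean with the EXACT rate `α = −max_{x > r} f(x)` (`LaiDecayInputs.alpha`,
`LaiDecaySplit` p244136; `isMax` from the kernel certificate `domCheck74`, `LaiDecayMax`), where
`f = laiProfile J r M δ` is the explicit 230-term sum of `y log y`'s. The numeric fields `decay_pos` / `margin`
of `LaiBoxInputs` need a certified LOWER BOUND for `α` (the margin needs `α > 38576.8…`; Lai's floating value is
`α̃ = 38725.88…`). This file supplies it, generically and then at the κ₃ point:

## Method (mean value theorem + the unimodality certificate; no second derivatives, no floating point)

Let `L, R` be Lai's balance polynomials (`laiProfL`, `laiProfR`; `f' = log L − log R` on `(r, ∞)`,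
`LaiDecayMax`), `x₀ > r` ANY maximiser of `f` on `(r, ∞)` and `a > r` a rational test point with
`L(a) ≤ R(a)` and `E := R(a) − L(a) < L(r)`. Fermat gives `L(x₀) = R(x₀)`; the kernel certificate `domCheck`
makes `L − R` strictly decreasing, so `x₀ ≤ a` and, for `c ∈ (x₀, a)`, `L(c) > R(c) − E ≥ θ·R(c)` with
`θ = (L(r) − E)/L(r) ∈ (0, 1]` (using `R(c) ≥ R(x₀) = L(x₀) ≥ L(r)`, monotonicity of `L`, `R`). By the mean
value theorem, `f(a) − f(x₀) = f'(c)(a − x₀) ≥ (a − r)·log θ`, and `−log θ ≤ 1/θ − 1 = E/(L(r) − E)`. Hence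

  `max f = f(x₀) ≤ f(a) + (a − r)·E/(L(r) − E)`            (`laiProfile_max_le_of_point`).

Every quantity on the right is either an exact rational (`L`, `R` at rational points: `profLQ`, `profRQ`) or a
sum of `y log y` at rationals, bounded above by the kernel interval logarithms of `KernelLog`
(`profileHiQ`, `laiProfile_le_profileHiQ`; the logarithms are the proved fixed-point kit
`Literature/Computability/AlgebraicComplexity/FixedPointLog.lean`). The Boolean `alphaCheck r M δs a B` tests the three side conditions
and `profileHiQ a + (a − r)E/(L(r) − E) ≤ −B` in exact rational arithmetic; its soundness theorem
`LaiDecayInputs.le_alpha_of_alphaCheck` gives `B ≤ α` for EVERY decay-input package at the ladder point.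

## The κ₃ certificate

`kappa3_alphaCheck : alphaCheck 2180 444 delta74 (2180 + 1/8) (38725 + 1/2) = true` — ONE `decide +kernel`
(a few seconds: 230 interval `y log y`'s at 40 bits / 12 series terms, products of 76 linear factors with
≤ 330-digit integers), and `kappa3_alpha_ge : 38725 + 1/2 ≤ d.alpha` for every `d : LaiDecayInputs 74 2180 444 δ Cn` with
`List.ofFn δ = delta74` — in particular for the instance `kappa3DecayInputs δ hδ` of `LaiDecayKappa3.lean`, whose
`decay` theorem is the `decay` field of `LaiBoxInputs 74 2180 444 δ 36`. (Lai's floating maximiser is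
`x₀ = 2180.0755…`, `α̃ = 38725.8847`; the test point `a = 2180 + 1/8` costs `0.24` nats, the interval logarithms
`< 0.01`.) Consequence for the skeleton: `decay_pos` (`Σ Dm − ϖ < α`, i.e. `32178 − ϖ < α`) and the α-side of
`margin` now only wait for the saving-rate enclosure `ϖ`.

References: [Lai2024BallRivoal] L. Lai, arXiv:2407.14236, §5 and §13 (the floating values); this cell's
families/indep/DECAY-L1.md §2 and KAPPA3.md §7.
-/

open Finset Set

namespace Summit.KontsevichZagierPeriods.Zeta5Search

open LaiBoxUnimodal KernelLog

section

variable {J r M : ℕ} {δ : Fin J → ℕ}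

/-! ### Exact rational evaluation of `L`, `R` and the interval upper bound of the profile -/

/-- `L(a) = a(a+M+r)∏_d (a+d)` in exact rational arithmetic over the list of shifts. [this file] -/
def profLQ (r M : ℕ) (δs : List ℕ) (a : ℚ) : ℚ := a * (a + M + r) * (δs.map (fun d : ℕ => a + d)).prod

/-- `R(a) = (a−r)(a+M)∏_d (a+M−d)` in exact rational arithmetic over the list of shifts. [this file] -/
def profRQ (r M : ℕ) (δs : List ℕ) (a : ℚ) : ℚ := (a - r) * (a + M) * (δs.map (fun d : ℕ => a + M - d)).prod

/-- Interval UPPER bound of the profile `f(a)` at a rational point: each `y log y` replaced by `xlnxHiQ`/`xlnxLoQ`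
according to its sign in `laiProfile`. [this file] -/
def profileHiQ (r M : ℕ) (δs : List ℕ) (a : ℚ) : ℚ :=
  (δs.map (fun d : ℕ => xlnxHiQ ((M : ℚ) - 2 * d))).sum + xlnxHiQ a - xlnxLoQ (a - r)
    + xlnxHiQ (a + M + r) - xlnxLoQ (a + M)
    - (δs.map (fun d : ℕ => xlnxLoQ (a + M - d) - xlnxHiQ (a + d))).sum

/-- **The checker.** Side conditions `r < a`, `L(a) ≤ R(a)`, `R(a) − L(a) < L(r)` and the bound
`profileHiQ a + (a − r)(R(a) − L(a))/(L(r) − (R(a) − L(a))) ≤ −B`, all in exact rational arithmetic. [this file] -/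
def alphaCheck (r M : ℕ) (δs : List ℕ) (a B : ℚ) : Bool :=
  let L := profLQ r M δs a
  let R := profRQ r M δs a
  let L0 := profLQ r M δs r
  decide ((r : ℚ) < a) && decide (L ≤ R) && decide (R - L < L0) &&
    decide (profileHiQ r M δs a + (a - r) * (R - L) / (L0 - (R - L)) ≤ -B)

/-- `profLQ` is `laiProfL` at the cast point. [this file] -/
theorem profLQ_cast (a : ℚ) : ((profLQ r M (List.ofFn δ) a : ℚ) : ℝ) = laiProfL J r M δ (a : ℝ) := by
  simp only [profLQ, laiProfL, List.map_ofFn, List.prod_ofFn, Function.comp_def]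
  push_cast
  ring

/-- `profRQ` is `laiProfR` at the cast point. [this file] -/
theorem profRQ_cast (a : ℚ) : ((profRQ r M (List.ofFn δ) a : ℚ) : ℝ) = laiProfR J r M δ (a : ℝ) := by
  simp only [profRQ, laiProfR, List.map_ofFn, List.prod_ofFn, Function.comp_def]
  push_cast
  ring

/-- **Soundness of the interval profile**: `f(a) ≤ profileHiQ a` at every rational point. [this file] -/
theorem laiProfile_le_profileHiQ (a : ℚ) :
    laiProfile J r M δ (a : ℝ) ≤ ((profileHiQ r M (List.ofFn δ) a : ℚ) : ℝ) := by
  have h1 : ∑ j : Fin J, xlnx ((M : ℝ) - 2 * (δ j : ℝ)) ≤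
      ((((List.ofFn δ).map (fun d : ℕ => xlnxHiQ ((M : ℚ) - 2 * d))).sum : ℚ) : ℝ) := by
    rw [Rat.cast_list_sum, List.map_map, List.map_ofFn, List.sum_ofFn]
    refine sum_le_sum fun j _ => ?_
    have := mul_log_le_xlnxHiQ ((M : ℚ) - 2 * (δ j : ℕ))
    push_cast at this
    simpa [xlnx] using this
  have h2 : ((((List.ofFn δ).map (fun d : ℕ => xlnxLoQ (a + M - d) - xlnxHiQ (a + d))).sum : ℚ) : ℝ) ≤
      ∑ j : Fin J, (xlnx ((a : ℝ) + M - δ j) - xlnx ((a : ℝ) + δ j)) := by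
    rw [Rat.cast_list_sum, List.map_map, List.map_ofFn, List.sum_ofFn]
    refine sum_le_sum fun j _ => ?_
    have e1 := xlnxLoQ_le (a + M - (δ j : ℕ))
    have e2 := mul_log_le_xlnxHiQ (a + (δ j : ℕ))
    push_cast at e1 e2
    simp only [Function.comp_apply, xlnx, Rat.cast_sub]
    linarith
  have h3 := mul_log_le_xlnxHiQ a
  have h4 := xlnxLoQ_le (a - r)
  have h5 := mul_log_le_xlnxHiQ (a + M + r)
  have h6 := xlnxLoQ_le (a + M)
  push_cast at h4 h5 h6
  unfold laiProfile
  simp only [xlnx] at h1 h2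
  simp only [profileHiQ, Rat.cast_add, Rat.cast_sub, xlnx]
  linarith

/-! ### Monotonicity of `L`, `R` and the mean-value bound on the maximum -/

/-- `L` is non-decreasing on `[0, ∞)`. [this file] -/
theorem laiProfL_mono {x y : ℝ} (hx : 0 ≤ x) (hxy : x ≤ y) : laiProfL J r M δ x ≤ laiProfL J r M δ y := by
  unfold laiProfL
  have h0 : ∀ j : Fin J, 0 ≤ x + δ j := fun j => by positivity
  refine mul_le_mul (mul_le_mul hxy (by linarith) (by positivity) (hx.trans hxy))
    (prod_le_prod (fun j _ => h0 j) (fun j _ => by linarith)) (prod_nonneg fun j _ => h0 j) ?_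
  have hy : 0 ≤ y := hx.trans hxy
  exact mul_nonneg hy (by positivity)

/-- `R` is non-decreasing on `[r, ∞)` (`δ_j ≤ M`). [this file] -/
theorem laiProfR_mono (hδ : ∀ j, δ j ≤ M) {x y : ℝ} (hx : (r : ℝ) ≤ x) (hxy : x ≤ y) :
    laiProfR J r M δ x ≤ laiProfR J r M δ y := by
  have hr : (0 : ℝ) ≤ r := Nat.cast_nonneg r
  have hδ' : ∀ j, (δ j : ℝ) ≤ M := fun j => by exact_mod_cast hδ j
  unfold laiProfR
  have h0 : ∀ j : Fin J, 0 ≤ x + M - δ j := fun j => by linarith [hδ' j]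
  refine mul_le_mul (mul_le_mul (by linarith) (by linarith) (by linarith) (by linarith))
    (prod_le_prod (fun j _ => h0 j) (fun j _ => by linarith)) (prod_nonneg fun j _ => h0 j) ?_
  exact mul_nonneg (by linarith) (by linarith)

/-- **The mean-value bound on the maximum.** With the unimodality certificate `domCheck`, a test point `a > r`
with `L(a) ≤ R(a)` and `E = R(a) − L(a) < L(r)`, every maximiser `x₀ > r` of the profile satisfies
`f(x₀) ≤ f(a) + (a − r)·E/(L(r) − E)`. [this file] -/
theorem laiProfile_max_le_of_point (hδ : ∀ j, δ j ≤ M)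
    (hdom : domCheck (linProdCoeffs (laiA r M (List.ofFn δ))) (linProdCoeffs (laiB r M (List.ofFn δ))) = true)
    {a : ℝ} (ha : (r : ℝ) < a) (hLR : laiProfL J r M δ a ≤ laiProfR J r M δ a)
    (hE : laiProfR J r M δ a - laiProfL J r M δ a < laiProfL J r M δ r)
    {x₀ : ℝ} (hx₀ : (r : ℝ) < x₀) (hmax : ∀ x : ℝ, (r : ℝ) < x → laiProfile J r M δ x ≤ laiProfile J r M δ x₀) :
    laiProfile J r M δ x₀ ≤ laiProfile J r M δ a +
      (a - r) * (laiProfR J r M δ a - laiProfL J r M δ a) /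
        (laiProfL J r M δ r - (laiProfR J r M δ a - laiProfL J r M δ a)) := by
  set L := laiProfL J r M δ with hL
  set R := laiProfR J r M δ with hR
  set f := laiProfile J r M δ with hf
  -- strict decrease of `L − R` in the variable `X = x − r ≥ 0`
  have hanti := strictAnti_of_domCheck hdom
  simp only [evalL_linProdCoeffs, laiA_prod_eq, laiB_prod_eq hδ] at hanti
  -- Fermat: `L(x₀) = R(x₀)`
  have hloc : IsLocalMax f x₀ :=
    Filter.eventually_of_mem (Ioi_mem_nhds hx₀) fun x hx => hmax x hx
  have hd0 : laiProfileDeriv J r M δ x₀ = 0 := hloc.hasDerivAt_eq_zero (hasDerivAt_laiProfile hδ hx₀)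
  have hx00 : 0 < x₀ := lt_of_le_of_lt (Nat.cast_nonneg r) hx₀
  have hLx : 0 < L x₀ := laiProfL_pos hx00
  have hRx : 0 < R x₀ := laiProfR_pos hδ hx₀
  have hLR0 : L x₀ = R x₀ := by
    rw [laiProfileDeriv_eq hδ hx₀, sub_eq_zero] at hd0
    exact Real.log_injOn_pos (mem_Ioi.2 hLx) (mem_Ioi.2 hRx) hd0
  -- `x₀ ≤ a`
  have hx₀a : x₀ ≤ a := by
    by_contra h
    push Not at h
    have := hanti (a - r) (x₀ - r) (by linarith) (by linarith)
    rw [show (r : ℝ) + (x₀ - r) = x₀ by ring, show (r : ℝ) + (a - r) = a by ring] at this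
    linarith
  set E := R a - L a with hEdef
  have hE0 : 0 ≤ E := by rw [hEdef]; linarith
  have hLr : E < L r := hE
  have hLr0 : 0 < L r := lt_of_le_of_lt hE0 hLr
  have hcorr : 0 ≤ (a - r) * E / (L r - E) := div_nonneg (mul_nonneg (by linarith) hE0) (by linarith)
  rcases hx₀a.eq_or_lt with h | h
  · rw [← h] at hcorr ⊢; linarith
  -- mean value theorem on `[x₀, a]`
  obtain ⟨c, hc, hcd⟩ := exists_hasDerivAt_eq_slope f (laiProfileDeriv J r M δ) h
    (continuous_laiProfile J r M δ).continuousOn (fun x hx => hasDerivAt_laiProfile hδ (hx₀.trans hx.1))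
  have hrc : (r : ℝ) < c := hx₀.trans hc.1
  have hRc0 : 0 < R c := laiProfR_pos hδ hrc
  have hLc0 : 0 < L c := laiProfL_pos (lt_of_le_of_lt (Nat.cast_nonneg r) hrc)
  -- `R(c) ≥ L(r)` and `L(c) > R(c) − E`
  have hRc : L r ≤ R c :=
    calc L r ≤ L x₀ := laiProfL_mono (Nat.cast_nonneg r) hx₀.le
      _ = R x₀ := hLR0
      _ ≤ R c := laiProfR_mono hδ hx₀.le hc.1.le
  have hDc : L a - R a < L c - R c := by
    have := hanti (c - r) (a - r) (by linarith) (by linarith [hc.2])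
    rw [show (r : ℝ) + (c - r) = c by ring, show (r : ℝ) + (a - r) = a by ring] at this
    exact this
  -- `θ = (L r − E)/L r ≤ L c / R c`
  have hkey : (L r - E) * R c ≤ L c * L r := by nlinarith
  have hθ0 : 0 < (L r - E) / L r := div_pos (by linarith) hLr0
  have hθ1 : (L r - E) / L r ≤ 1 := by rw [div_le_one hLr0]; linarith
  have hθle : (L r - E) / L r ≤ L c / R c := by rw [div_le_div_iff₀ hLr0 hRc0]; exact hkey
  have hderiv : Real.log ((L r - E) / L r) ≤ laiProfileDeriv J r M δ c := by
    rw [laiProfileDeriv_eq hδ hrc, ← Real.log_div hLc0.ne' hRc0.ne']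
    exact Real.log_le_log hθ0 hθle
  have hlogθ : Real.log ((L r - E) / L r) ≤ 0 := Real.log_nonpos hθ0.le hθ1
  -- combine
  have hslope : laiProfileDeriv J r M δ c * (a - x₀) = f a - f x₀ := by
    rw [hcd, div_mul_cancel₀ _ (by linarith)]
  have hm1 : Real.log ((L r - E) / L r) * (a - r) ≤ Real.log ((L r - E) / L r) * (a - x₀) :=
    mul_le_mul_of_nonpos_left (by linarith) hlogθ
  have hm2 : Real.log ((L r - E) / L r) * (a - x₀) ≤ laiProfileDeriv J r M δ c * (a - x₀) :=
    mul_le_mul_of_nonneg_right hderiv (by linarith)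
  have hinv : -Real.log ((L r - E) / L r) ≤ E / (L r - E) := by
    have h1 := Real.log_le_sub_one_of_pos (inv_pos.2 hθ0)
    rw [Real.log_inv] at h1
    have hne : L r - E ≠ 0 := (sub_pos.2 hLr).ne'
    have h2 : ((L r - E) / L r)⁻¹ - 1 = E / (L r - E) := by
      rw [inv_div, div_sub_one hne]
      ring
    linarith
  have hm3 : -Real.log ((L r - E) / L r) * (a - r) ≤ E / (L r - E) * (a - r) :=
    mul_le_mul_of_nonneg_right hinv (by linarith)
  have hm4 : E / (L r - E) * (a - r) = (a - r) * E / (L r - E) := by ring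
  linarith

/-- **Soundness of the checker**: `alphaCheck r M (List.ofFn δ) a B = true` gives `B ≤ α` for EVERY decay-input
package at the ladder point (`α = −f(x₀)`, `x₀` its maximiser). [this file] -/
theorem LaiDecayInputs.le_alpha_of_alphaCheck {Cn : ℕ → ℚ} (d : LaiDecayInputs J r M δ Cn) (hδ : ∀ j, δ j ≤ M)
    (hdom : domCheck (linProdCoeffs (laiA r M (List.ofFn δ))) (linProdCoeffs (laiB r M (List.ofFn δ))) = true)
    {a B : ℚ} (h : alphaCheck r M (List.ofFn δ) a B = true) : (B : ℝ) ≤ d.alpha := by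
  simp only [alphaCheck, Bool.and_eq_true, decide_eq_true_eq] at h
  obtain ⟨⟨⟨h1, h2⟩, h3⟩, h4⟩ := h
  have h1' : (r : ℝ) < (a : ℝ) := by exact_mod_cast h1
  have h2' := (Rat.cast_le (K := ℝ)).2 h2
  have h3' := (Rat.cast_lt (K := ℝ)).2 h3
  have h4' := (Rat.cast_le (K := ℝ)).2 h4
  push_cast [profLQ_cast, profRQ_cast] at h2' h3' h4'
  have hmain := laiProfile_max_le_of_point hδ hdom h1' h2' h3' d.r_lt_x₀ d.isMax
  have hprof := laiProfile_le_profileHiQ (J := J) (r := r) (M := M) (δ := δ) a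
  show (B : ℝ) ≤ -laiProfile J r M δ d.x₀
  linarith

end

/-! ### The κ₃ ladder point `(74, 2180, 444, delta74)` -/

/-- **κ₃ KERNEL CERTIFICATE** at the test point `a = 2180 + 1/8`: side conditions and
`profileHiQ a + (a − r)E/(L(r) − E) ≤ −(38725 + 1/2)`, by ONE `decide +kernel`. [this file] -/
theorem kappa3_alphaCheck : alphaCheck 2180 444 delta74 (2180 + 1 / 8) (38725 + 1 / 2) = true := by
  decide +kernel

/-- **κ₃ LADDER POINT — DECAY RATE ENCLOSED FROM BELOW: `α ≥ 38725.5`** for every decay-input package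
`d : LaiDecayInputs 74 2180 444 δ Cn` with `δ` listing the tree's `delta74` (in particular for `kappa3DecayInputs δ hδ`
of `LaiDecayKappa3.lean`, whose `decay` is the `decay` field of `LaiBoxInputs 74 2180 444 δ 36`). Lai's floating
value: `α̃ = 38725.8847`. MANUSCRIPT-LEVEL CANDIDATE context; no margin / dimension claim. [this file] -/
theorem kappa3_alpha_ge {δ : Fin 74 → ℕ} (hδ : List.ofFn δ = delta74) {Cn : ℕ → ℚ}
    (d : LaiDecayInputs 74 2180 444 δ Cn) : (38725 : ℝ) + 1 / 2 ≤ d.alpha := by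
  have hmem : ∀ j, δ j ∈ delta74 := fun j => hδ ▸ List.mem_ofFn.2 ⟨j, rfl⟩
  have hall : ∀ e ∈ delta74, e ≤ 444 := by decide
  have hδM : ∀ j, δ j ≤ 444 := fun j => hall _ (hmem j)
  have hdom : domCheck (linProdCoeffs (laiA 2180 444 (List.ofFn δ))) (linProdCoeffs (laiB 2180 444 (List.ofFn δ)))
      = true := by rw [hδ]; exact domCheck74
  have h := kappa3_alphaCheck
  rw [← hδ] at h
  have := d.le_alpha_of_alphaCheck hδM hdom h
  push_cast at this
  exact this

/-- Readable corollary: `32178 < α` — the `decay_pos` inequality `Σ_j Dm_j − ϖ < α` of the κ₃ skeleton holds for every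
`ϖ ≥ 0` (`Σ_j Dm_j = 32178`, `LaiPhiTilde.sum_Dm74`). MANUSCRIPT-LEVEL CANDIDATE context. [this file] -/
theorem kappa3_sumDm_lt_alpha {δ : Fin 74 → ℕ} (hδ : List.ofFn δ = delta74) {Cn : ℕ → ℚ}
    (d : LaiDecayInputs 74 2180 444 δ Cn) {ϖ : ℝ} (hϖ : 0 ≤ ϖ) : (32178 : ℝ) - ϖ < d.alpha := by
  have := kappa3_alpha_ge hδ d
  linarith

end Summit.KontsevichZagierPeriods.Zeta5Search
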